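import Summits.HubbardSuperconductivity.HubbardSuperconductivity.Theorems.JosephsonMirrorJmInterchangeFloorCoupling
import Summits.HubbardSuperconductivity.HubbardSuperconductivity.Theorems.JosephsonMirrorJmInterchangeHypGivesZEPO
import Summits.HubbardSuperconductivity.HubbardSuperconductivity.Theorems.WeakCouplingBCSWcbcsSsbToTorusLROMomentClosure
import Literature.MathematicalPhysics.QuantumLattice.FinDimSpectrumSectorGibbsLimit
import Literature.MathematicalPhysics.QuantumLattice.LTQOProofs
import Literature.MathematicalPhysics.QuantumLattice.SectorEigenvalueContinuation
import Literature.MathematicalPhysics.QuantumLattice.HubbardModelThermodynamicLimitProofs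

/-!
# Route `JosephsonMirror` — crux `JmInterchange` (stmt-HubbardSuperconductivity-2227), line `Sketch`:
# tools for the rate form of the interchange (floor projections, variance gap, pairing bound)

Helper file (lead c2).  Three finite-dimensional facts used by `Theorems/JosephsonMirrorJmInterchangeRateForm.lean`:

* `star_proj_dotProduct`, `re_self_eq_proj_add_perp` — algebra of a Hermitian idempotent `Q` (`⟨Qx, y⟩ = ⟨Qx, Qy⟩`,
  Pythagoras `‖v‖² = ‖Qv‖² + ‖v - Qv‖²`);
* `variance_gap_of_sectorGap` — for a Hermitian `H`, a subspace `K`, a level `e` and a gap `γ` ABOVE the floor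
  `F = K ⊓ ker (H - e)` inside `K` (`(e + γ)‖w‖² ≤ Re ⟨w, H w⟩` for `w ∈ K` orthogonal to `F`), the gap in VARIANCE FORM
  `γ ‖v - P_F v‖² ≤ Re ⟨v, H v⟩ - e ‖v‖²` for every `v ∈ K` (`P_F` the orthogonal projection);
* `pairing_sq_le_of_noBridge` — on the Hubbard torus: if NO pair of unit ground states `φ ∈ G(N, 0)`, `χ ∈ G(N-2, 0)`
  has `b ≤ |⟨χ, Δ_d φ⟩|²`, then `|⟨χ, Δ_d φ⟩|² ≤ b ‖χ‖² ‖φ‖²` for ALL floor vectors (homogeneity).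

Sources: H. Tasaki, *Physics and Mathematics of Quantum Many-Body Systems* (2020) §2.1, App. A.2 (variational
principle, projections); T. Kato, *Perturbation Theory for Linear Operators* (1966) I §6.  Folklore linear algebra.
No new definitions.
-/

-- the mandated namespace `Summit.<Summit>.<Problem>.Theorems` repeats `HubbardSuperconductivity`
-- (single-problem summit, D-0017), which the `dupNamespace` linter flags on every declaration
set_option linter.dupNamespace false

namespace Summit.HubbardSuperconductivity.HubbardSuperconductivity.Theorems.JosephsonMirror

open Matrix Literature.MathematicalPhysics.QuantumLattice
open Literature.MathematicalPhysics.QuantumLattice.EigenvalueContinuation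
open scoped ComplexOrder

section Proj

variable {n : Type*} [Fintype n]

/-- `⟨Q x, y⟩ = ⟨Q x, Q y⟩` for a Hermitian idempotent `Q`. [folklore] -/
theorem star_proj_dotProduct {Q : Matrix n n ℂ} (hQ : Qᴴ = Q) (hQQ : Q * Q = Q) (x y : n → ℂ) :
    star (Q *ᵥ x) ⬝ᵥ y = star (Q *ᵥ x) ⬝ᵥ (Q *ᵥ y) := by
  rw [star_mulVec, ← dotProduct_mulVec, ← dotProduct_mulVec, hQ, mulVec_mulVec, hQQ]

/-- Pythagoras for a Hermitian idempotent `Q`: `‖v‖² = ‖Q v‖² + ‖v - Q v‖²`. [folklore] -/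
theorem re_self_eq_proj_add_perp {Q : Matrix n n ℂ} (hQ : Qᴴ = Q) (hQQ : Q * Q = Q) (v : n → ℂ) :
    (star v ⬝ᵥ v).re = (star (Q *ᵥ v) ⬝ᵥ (Q *ᵥ v)).re + (star (v - Q *ᵥ v) ⬝ᵥ (v - Q *ᵥ v)).re := by
  have h1 : star (Q *ᵥ v) ⬝ᵥ (v - Q *ᵥ v) = 0 := by
    rw [dotProduct_sub, star_proj_dotProduct hQ hQQ v v, sub_self]
  have h2 : star (v - Q *ᵥ v) ⬝ᵥ (Q *ᵥ v) = 0 := by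
    have := congrArg star h1
    rwa [star_dotProduct, star_star, star_zero] at this
  have hv : star v ⬝ᵥ v = star (Q *ᵥ v + (v - Q *ᵥ v)) ⬝ᵥ (Q *ᵥ v + (v - Q *ᵥ v)) := by
    rw [add_sub_cancel]
  rw [hv, star_add, add_dotProduct, dotProduct_add, dotProduct_add, h1, h2, add_zero, zero_add,
    Complex.add_re]

/-- A Hermitian idempotent is a contraction: `‖Q v‖² ≤ ‖v‖²`. [folklore] -/
theorem re_proj_self_le {Q : Matrix n n ℂ} (hQ : Qᴴ = Q) (hQQ : Q * Q = Q) (v : n → ℂ) :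
    (star (Q *ᵥ v) ⬝ᵥ (Q *ᵥ v)).re ≤ (star v ⬝ᵥ v).re := by
  rw [re_self_eq_proj_add_perp hQ hQQ v]
  have := (Complex.nonneg_iff.1 (dotProduct_star_self_nonneg (v - Q *ᵥ v))).1
  linarith

/-- `⟨g, Q v⟩ = ⟨g, v⟩` when the Hermitian `Q` fixes `g`. [folklore] -/
theorem star_dotProduct_proj_of_fixed {Q : Matrix n n ℂ} (hQ : Qᴴ = Q) {g : n → ℂ} (hg : Q *ᵥ g = g)
    (v : n → ℂ) : star g ⬝ᵥ (Q *ᵥ v) = star g ⬝ᵥ v := by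
  calc star g ⬝ᵥ (Q *ᵥ v) = (star g ᵥ* Q) ⬝ᵥ v := dotProduct_mulVec _ _ _
    _ = star (Q *ᵥ g) ⬝ᵥ v := by rw [star_mulVec, hQ]
    _ = star g ⬝ᵥ v := by rw [hg]

end Proj

section VarianceGap

variable {n : Type*} [Fintype n] [DecidableEq n]

/-- **The gap in variance form.** `H` Hermitian, `K` a subspace, `e` a level and `γ` a gap above the floor
`F = K ⊓ eigenspace H e` inside `K`: `(e + γ) ‖w‖² ≤ Re ⟨w, H w⟩` for every `w ∈ K` orthogonal to all
`e`-eigenvectors in `K`.  Then for every `v ∈ K`, with `P_F` the orthogonal projection onto `F`,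
`γ ‖v - P_F v‖² ≤ Re ⟨v, H v⟩ - e ‖v‖²` (split `v = P_F v + w`; the cross terms vanish because `H P_F v = e P_F v`
and `w ⊥ F`).  Tasaki (2020) §2.1. [folklore] -/
theorem variance_gap_of_sectorGap {H : Matrix n n ℂ} (hH : H.IsHermitian) (K : Submodule ℂ (n → ℂ)) (e γ : ℝ)
    (hgap : ∀ w ∈ K, (∀ g ∈ K, H *ᵥ g = (e : ℂ) • g → star g ⬝ᵥ w = 0) →
      (e + γ) * (star w ⬝ᵥ w).re ≤ (star w ⬝ᵥ H *ᵥ w).re)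
    (v : n → ℂ) (hv : v ∈ K) :
    γ * (star (v - projMatrix ((K ⊓ Module.End.eigenspace (Matrix.toLin' H) (e : ℂ)).map
        ((WithLp.linearEquiv 2 ℂ (n → ℂ)).symm : (n → ℂ) →ₗ[ℂ] EuclideanSpace ℂ n)) *ᵥ v) ⬝ᵥ
      (v - projMatrix ((K ⊓ Module.End.eigenspace (Matrix.toLin' H) (e : ℂ)).map
        ((WithLp.linearEquiv 2 ℂ (n → ℂ)).symm : (n → ℂ) →ₗ[ℂ] EuclideanSpace ℂ n)) *ᵥ v)).re ≤
      (star v ⬝ᵥ H *ᵥ v).re - e * (star v ⬝ᵥ v).re := by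
  set F : Submodule ℂ (n → ℂ) := K ⊓ Module.End.eigenspace (Matrix.toLin' H) (e : ℂ) with hF
  set Q : Matrix n n ℂ := projMatrix (F.map
    ((WithLp.linearEquiv 2 ℂ (n → ℂ)).symm : (n → ℂ) →ₗ[ℂ] EuclideanSpace ℂ n)) with hQ
  have hmemF : ∀ u, u ∈ F ↔ u ∈ K ∧ H *ᵥ u = (e : ℂ) • u := fun u => by
    rw [hF, Submodule.mem_inf, Module.End.mem_eigenspace_iff, Matrix.toLin'_apply]
  have hQH : Qᴴ = Q := (projMatrix_isHermitian _).eq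
  -- the floor part `f = Q v` and the remainder `w = v - f`
  set f : n → ℂ := Q *ᵥ v with hf
  set w : n → ℂ := v - f with hw
  have hfF : f ∈ F := projMatrix_map_mulVec_mem F v
  obtain ⟨hfK, hHf⟩ := (hmemF f).1 hfF
  have hwK : w ∈ K := K.sub_mem hv hfK
  -- `w ⊥ F`
  have hworth : ∀ g ∈ K, H *ᵥ g = (e : ℂ) • g → star g ⬝ᵥ w = 0 := by
    intro g hgK hHg
    have hgF : g ∈ F := (hmemF g).2 ⟨hgK, hHg⟩
    have hQg : Q *ᵥ g = g := projMatrix_map_mulVec_of_mem F hgF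
    rw [hw, dotProduct_sub, hf, star_dotProduct_proj_of_fixed hQH hQg v, sub_self]
  have hgapw := hgap w hwK hworth
  -- cross terms
  have hfw : star f ⬝ᵥ w = 0 := hworth f hfK hHf
  have hwf : star w ⬝ᵥ f = 0 := by
    have := congrArg star hfw
    rwa [star_dotProduct, star_star, star_zero] at this
  have hfHw : star f ⬝ᵥ H *ᵥ w = 0 := by
    rw [star_dotProduct_mulVec_comm hH.eq, hHf, dotProduct_smul, hwf, smul_zero, star_zero]
  have hwHf : star w ⬝ᵥ H *ᵥ f = 0 := by
    rw [hHf, dotProduct_smul, hwf, smul_zero]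
  have hfHf : star f ⬝ᵥ H *ᵥ f = (e : ℂ) * (star f ⬝ᵥ f) := by
    rw [hHf, dotProduct_smul, smul_eq_mul]
  -- `v = f + w`
  have hvfw : v = f + w := by rw [hw]; abel
  have hvv : (star v ⬝ᵥ v).re = (star f ⬝ᵥ f).re + (star w ⬝ᵥ w).re := by
    conv_lhs => rw [hvfw]
    rw [star_add, add_dotProduct, dotProduct_add, dotProduct_add, hfw, hwf, add_zero, zero_add,
      Complex.add_re]
  have hvHv : (star v ⬝ᵥ H *ᵥ v).re = e * (star f ⬝ᵥ f).re + (star w ⬝ᵥ H *ᵥ w).re := by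
    conv_lhs => rw [hvfw]
    rw [mulVec_add, star_add, add_dotProduct, dotProduct_add, dotProduct_add, hfHw, hwHf, hfHf, add_zero,
      zero_add, Complex.add_re, Complex.re_ofReal_mul]
  rw [hvv, hvHv]
  nlinarith [hgapw]

end VarianceGap

section Torus

variable {L : ℕ} [NeZero L]

/-- **Homogeneous pairing bound from the absence of a floor bridge.** On the Hubbard torus, if no pair of unit
sector ground states `φ ∈ G(N, 0)`, `χ ∈ G(N - 2, 0)` of `hubbardTorus 2 L 1 U` has `b ≤ |⟨χ, Δ_d φ⟩|²`, then
`|⟨χ, Δ_d φ⟩|² ≤ b ‖χ‖² ‖φ‖²` for ALL vectors `φ`, `χ` of the two floors (normalise; zero vectors are trivial).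
[folklore] -/
theorem pairing_sq_le_of_noBridge (U : ℝ) (N : ℕ) {b : ℝ}
    (hno : ∀ φ χ : Fock (Orb (FermionTorus 2 L)),
      IsGroundStateInSector (hubbardTorus 2 L 1 U) N 0 φ → star φ ⬝ᵥ φ = 1 →
        IsGroundStateInSector (hubbardTorus 2 L 1 U) (N - 2) 0 χ → star χ ⬝ᵥ χ = 1 →
          ‖star χ ⬝ᵥ (pairField dWaveFormFactor L *ᵥ φ)‖ ^ 2 < b)
    (φ χ : Fock (Orb (FermionTorus 2 L)))
    (hφ : φ ∈ szSector N 0 ⊓ Module.End.eigenspace (Matrix.toLin' (hubbardTorus 2 L 1 U))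
      (((hubbardTorus 2 L 1 U).minEnergyOn (szSector N 0) : ℝ) : ℂ))
    (hχ : χ ∈ szSector (N - 2) 0 ⊓ Module.End.eigenspace (Matrix.toLin' (hubbardTorus 2 L 1 U))
      (((hubbardTorus 2 L 1 U).minEnergyOn (szSector (N - 2) 0) : ℝ) : ℂ)) :
    ‖star χ ⬝ᵥ (pairField dWaveFormFactor L *ᵥ φ)‖ ^ 2 ≤ b * ((star χ ⬝ᵥ χ).re * (star φ ⬝ᵥ φ).re) := by
  set H := hubbardTorus 2 L 1 U with hHdef
  set Δ := pairField dWaveFormFactor L with hΔ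
  have hGS : ∀ (m : ℕ) (ψ : Fock (Orb (FermionTorus 2 L))),
      ψ ∈ szSector m 0 ⊓ Module.End.eigenspace (Matrix.toLin' H) ((H.minEnergyOn (szSector m 0) : ℝ) : ℂ) →
        ψ ≠ 0 → IsGroundStateInSector H m 0 ψ := by
    intro m ψ hψ hψ0
    rw [Submodule.mem_inf, Module.End.mem_eigenspace_iff, Matrix.toLin'_apply] at hψ
    exact ⟨hψ.1, hψ0, hψ.2⟩
  by_cases hφ0 : φ = 0
  · subst hφ0
    simp
  by_cases hχ0 : χ = 0
  · subst hχ0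
    simp
  obtain ⟨c, hc0, hcc, hc1⟩ := exists_normalize hχ0
  obtain ⟨d, hd0, hdd, hd1⟩ := exists_normalize hφ0
  have hφ' : IsGroundStateInSector H N 0 ((d : ℂ) • φ) :=
    hGS N _ (Submodule.smul_mem _ _ hφ) (smul_ne_zero (by exact_mod_cast hd0.ne') hφ0)
  have hχ' : IsGroundStateInSector H (N - 2) 0 ((c : ℂ) • χ) :=
    hGS (N - 2) _ (Submodule.smul_mem _ _ hχ) (smul_ne_zero (by exact_mod_cast hc0.ne') hχ0)
  have hlt := hno _ _ hφ' hd1 hχ' hc1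
  have hsc : star ((c : ℂ) • χ) ⬝ᵥ (Δ *ᵥ ((d : ℂ) • φ)) = ((c * d : ℝ) : ℂ) * (star χ ⬝ᵥ (Δ *ᵥ φ)) := by
    rw [mulVec_smul, star_smul, smul_dotProduct, dotProduct_smul, smul_smul, Complex.star_def,
      Complex.conj_ofReal, smul_eq_mul, Complex.ofReal_mul]
  rw [hsc, norm_mul, mul_pow, Complex.norm_real, Real.norm_eq_abs, sq_abs] at hlt
  -- multiply through by `‖χ‖² ‖φ‖²` and use `c² ‖χ‖² = 1 = d² ‖φ‖²`
  set X : ℝ := ‖star χ ⬝ᵥ (Δ *ᵥ φ)‖ ^ 2 with hX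
  set nχ : ℝ := (star χ ⬝ᵥ χ).re
  set nφ : ℝ := (star φ ⬝ᵥ φ).re
  have hX0 : 0 ≤ X := by positivity
  have hnχ : 0 < nχ := re_star_dotProduct_self_pos hχ0
  have hnφ : 0 < nφ := re_star_dotProduct_self_pos hφ0
  have key : X = (c * d) ^ 2 * X * (nχ * nφ) := by
    have : (c * d) ^ 2 * (nχ * nφ) = (c * c * nχ) * (d * d * nφ) := by ring
    rw [mul_assoc, mul_comm X, ← mul_assoc, this, hcc, hdd, one_mul, one_mul]
  rw [key]
  have := mul_lt_mul_of_pos_right hlt (mul_pos hnχ hnφ)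
  exact this.le

/-- **Registered form** (sub-goal `pairingSqLeOfNoBridge` of line `Sketch`, crux `JmInterchange`): the statement of
`pairing_sq_le_of_noBridge` as one closed proposition, so that the ledger can match it by name and signature. [folklore] -/
theorem pairingSqLeOfNoBridge : ∀ {L : ℕ} [NeZero L] (U : ℝ) (N : ℕ) {b : ℝ}, (∀ φ χ : Fock (Orb (FermionTorus 2 L)), IsGroundStateInSector (hubbardTorus 2 L 1 U) N 0 φ → star φ ⬝ᵥ φ = 1 → IsGroundStateInSector (hubbardTorus 2 L 1 U) (N - 2) 0 χ → star χ ⬝ᵥ χ = 1 → ‖star χ ⬝ᵥ (pairField dWaveFormFactor L *ᵥ φ)‖ ^ 2 < b) → ∀ (φ χ : Fock (Orb (FermionTorus 2 L))), φ ∈ szSector N 0 ⊓ Module.End.eigenspace (Matrix.toLin' (hubbardTorus 2 L 1 U)) (((hubbardTorus 2 L 1 U).minEnergyOn (szSector N 0) : ℝ) : ℂ) → χ ∈ szSector (N - 2) 0 ⊓ Module.End.eigenspace (Matrix.toLin' (hubbardTorus 2 L 1 U)) (((hubbardTorus 2 L 1 U).minEnergyOn (szSector (N - 2) 0) : ℝ)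 : ℂ) → ‖star χ ⬝ᵥ (pairField dWaveFormFactor L *ᵥ φ)‖ ^ 2 ≤ b * ((star χ ⬝ᵥ χ).re * (star φ ⬝ᵥ φ).re) :=
  fun U N _ hno φ χ hφ hχ => pairing_sq_le_of_noBridge U N hno φ χ hφ hχ

end Torus

end Summit.HubbardSuperconductivity.HubbardSuperconductivity.Theorems.JosephsonMirror
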